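import Literature.Geometry.Kaehler.ComplexTorusHodgeGroupProductKernelsRational
import Literature.Geometry.Kaehler.ComplexTorusLefschetzGroupIsogenyIdentityComponent
import Literature.Geometry.Kaehler.ComplexTorusHodgeGroupComplexPointsTransport
import HarnessLib

/-!
# «`Hg(X)` almost `ℚ`-simple» is an isogeny invariant: `Hg(X₂)(ℂ) = V(f) · Hg(X₁)(ℂ) · V(f)⁻¹` as subgroups for a
# `Hom_ℚ`-isomorphism `V(f)`, transport of Zariski-closed `Aut(ℂ)`-stable normal subgroups along it, and the
# Moonen–Zarhin dichotomy for a factor ISOGENOUS to one with almost `ℚ`-simple Hodge group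

Layer `Literature/Geometry/Kaehler`, namespace `Literature.Geometry.Kaehler.ComplexTorus`; lane `lit-hodgefound` (Track 2
foundations library), Layer A3/A4; prover seat `lit-hodgefound-p17` (generation 43, self-proposed row g43-#4, sequel of g43-#2
`ComplexTorusHodgeGroupProductKernelsRational` (the `ℚ`-subgroup rendering `(hQ′)` of «`Hg(X)` almost `ℚ`-simple» and its
equivalence with the Lie-algebra rendering `(hQ)`), on top of p17's `ComplexTorusLefschetzGroupIsogenyIdentityComponent` (Milne's
map `γ ↦ P γ Q` on `SL(ℂ)`: `conjSLC`, transport of Zariski-closedness and, for RATIONAL `P`, `Q`, of `Aut(ℂ)`-stability) and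
p22's `ComplexTorusHodgeGroupComplexPointsTransport` (`N ∈ Hg(X₂)(ℂ) ⟺ N = P M Q`, `M ∈ Hg(X₁)(ℂ)`)).  THEOREMS ONLY (no
definition, no instance, no notation, no named fact; D-0026 net debt 0).

Moonen–Zarhin (0.2)(4): the Hodge group depends only on the isogeny class — for mutually inverse `P ∈ Hom_ℚ(X₁, X₂)`,
`Q ∈ Hom_ℚ(X₂, X₁)` (e.g. `P = V(f)` of an isogeny `f`), `Hg(X₂)(ℂ) = P · Hg(X₁)(ℂ) · Q` (§1, as an equality of
subgroups of `SL(V₂ ⊗ ℂ)`: `hodgeGroupC_eq_map_conjSLC_of_homRat`).  Conjugation by the RATIONAL isomorphism `P` carries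
Zariski-closed, `Aut(ℂ)`-stable, normal subgroups of `Hg(X₁)(ℂ)` to the like in `Hg(X₂)(ℂ)`, finite to finite and all to all;
hence (§2) the `ℚ`-group hypothesis `(hQ′)` «every Zariski-closed `Aut(ℂ)`-stable `N ≤ Hg(X)(ℂ)` normalised by `Hg(X)(ℂ)` is
finite or `Hg(X)(ℂ)`» holds for `X₂` iff it holds for `X₁` (**`almostRatSimple_iff_of_homRat`**, `IsIsogeny.almostRatSimple_iff`,
**`IsIsogenous.almostRatSimple_iff`**), and so does g43-#1's Lie-algebra rendering `(hQ)` (**`IsIsogenous.almostQSimple_iff`**, through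
g43-#2's `almostRatSimple_iff_almostQSimple`).  §3 feeds this into the product dichotomy: for `X₂ ∼ X₂'` with `Hg(X₂')` almost
`ℚ`-simple, `K₂` is finite or `K₂ = Hg(X₂)(ℂ)` (`IsIsogenous.finite_hodgeGroupCProdInr_or_eq_of_almostRatSimple`), etc.

## Sources, verbatim

* B. Moonen, Yu. G. Zarhin [MoonenZarhin1999LowDim], Math. Ann. 315 (1999), (0.2)(4) («isogenous abelian varieties have
  isomorphic Hodge groups») and §3 Lemma (3.6), proof (held `paper:arxiv-math_9901113` p0007 L18–L25).
* M. Green, P. Griffiths, M. Kerr [GreenGriffithsKerr2012], §I.B (I.B.3)–(I.B.4) (the Mumford–Tate ∕ Hodge group of `V` and of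
  an isomorphic Hodge structure are conjugate by the isomorphism).
* B. van Geemen [vanGeemen1994HodgeAV], 3.6.  J. S. Milne [Milne1999LefschetzClasses], §1 (p. 643: `γ ↦ V(α) ∘ γ ∘ V(α)⁻¹`
  «is an isomorphism»).  J. S. Milne [Milne2017], Def. 19.7 (almost-simple).  T. A. Springer [Springer1998], Prop. 2.2.1
  (inner automorphisms are homeomorphisms for the Zariski topology), 11.2.8 (i), 12.1.1.  H. Imai [Imai1976HodgeGroups], §2
  (p. 368: «`h^σ ∈ H`»).
-/

noncomputable section

open Matrix Module Function

namespace Literature.Geometry.Kaehler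

namespace ComplexTorus

open Literature.NumberTheory.Automorphic (IsZConnected lieAlgebraGL)

section Isogeny

variable {ι₁ ι₂ : Type*} [Fintype ι₁] [Fintype ι₂] [DecidableEq ι₁] [DecidableEq ι₂]
  {E₁ E₂ : Type*} [NormedAddCommGroup E₁] [NormedSpace ℂ E₁] [NormedAddCommGroup E₂] [NormedSpace ℂ E₂]
  {Φ₁ : (ι₁ → ℝ) ≃L[ℝ] E₁} {Φ₂ : (ι₂ → ℝ) ≃L[ℝ] E₂}

omit [Fintype ι₁] [DecidableEq ι₂] in
/-- Complexification of `Q P = 1`. [folklore] -/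
private theorem mapC_mul_eq_one₄₃ {Q : Matrix ι₁ ι₂ ℚ} {P : Matrix ι₂ ι₁ ℚ} (hQP : Q * P = 1) :
    Q.map (algebraMap ℚ ℂ) * P.map (algebraMap ℚ ℂ) = 1 := by
  rw [← Matrix.map_mul, hQP, Matrix.map_one _ (map_zero _) (map_one _)]

/-! ### §1 `Hg(X₂)(ℂ) = P · Hg(X₁)(ℂ) · Q` as subgroups of `SL(V₂ ⊗ ℂ)` -/

/-- **ISOGENY INVARIANCE OF THE HODGE GROUP, AS AN EQUALITY OF SUBGROUPS OF `SL(V₂ ⊗ ℂ)`: `Hg(X₂)(ℂ) = P · Hg(X₁)(ℂ) · Q`**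
for mutually inverse `P ∈ Hom_ℚ(X₁, X₂)`, `Q` (the image of `Hg(X₁)(ℂ)` under Milne's map `γ ↦ P γ Q`).
[cite: MoonenZarhin1999LowDim, (0.2)(4)] [cite: GreenGriffithsKerr2012, §I.B (I.B.3), (I.B.4)] [cite: Milne1999LefschetzClasses, §1 (p. 643)] -/
theorem hodgeGroupC_eq_map_conjSLC_of_homRat {P : Matrix ι₂ ι₁ ℚ} {Q : Matrix ι₁ ι₂ ℚ} (hP : P ∈ homRat Φ₁ Φ₂)
    (hQP : Q * P = 1) (hPQ : P * Q = 1) :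
    hodgeGroupC Φ₂ = (hodgeGroupC Φ₁).map (conjSLC (P.map (algebraMap ℚ ℂ)) (Q.map (algebraMap ℚ ℂ))
      (mapC_mul_eq_one₄₃ hQP) (mapC_mul_eq_one₄₃ hPQ)) := by
  ext N
  rw [mem_hodgeGroupC_iff_of_homRat hP hQP hPQ, Subgroup.mem_map]
  refine exists_congr fun M ↦ and_congr_right fun _ ↦ ⟨fun h ↦ Subtype.ext h, fun h ↦ ?_⟩
  rw [← h]
  rfl

/-- The same for an isogeny `f : X₁ → X₂` with rational representation `A` and `Q = A_ℚ⁻¹`: `Hg(X₂)(ℂ) = A · Hg(X₁)(ℂ) · A⁻¹`.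
[cite: MoonenZarhin1999LowDim, (0.2)(4)] [cite: vanGeemen1994HodgeAV, 3.6] -/
theorem IsIsogeny.hodgeGroupC_eq_map_conjSLC {A : Matrix ι₂ ι₁ ℤ} (hA : IsIsogeny Φ₁ Φ₂ A) {Q : Matrix ι₁ ι₂ ℚ}
    (hQP : Q * A.map (Int.cast : ℤ → ℚ) = 1) (hPQ : A.map (Int.cast : ℤ → ℚ) * Q = 1) :
    hodgeGroupC Φ₂ = (hodgeGroupC Φ₁).map (conjSLC ((A.map (Int.cast : ℤ → ℚ)).map (algebraMap ℚ ℂ))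
      (Q.map (algebraMap ℚ ℂ)) (mapC_mul_eq_one₄₃ hQP) (mapC_mul_eq_one₄₃ hPQ)) :=
  hodgeGroupC_eq_map_conjSLC_of_homRat hA.map_intCast_mem_homRat hQP hPQ

/-! ### §2 Transport of `(hQ′)` along `γ ↦ P γ Q` -/

/-- **TRANSPORT: `(hQ′)` for `X₁` ⟹ `(hQ′)` for `X₂`** whenever `Hom_ℚ(X₁, X₂)` contains an isomorphism `P` (inverse `Q`): a
Zariski-closed, `Aut(ℂ)`-stable `N ≤ Hg(X₂)(ℂ)` normalised by `Hg(X₂)(ℂ)` pulls back to `Q N P ≤ Hg(X₁)(ℂ)` of the same kind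
(`P`, `Q` are RATIONAL, so `Aut(ℂ)`-stability is preserved; inner automorphisms are Zariski homeomorphisms), finite iff `N` is,
all iff `N` is. [cite: Springer1998, Prop. 2.2.1 and 11.2.8 (i)] [cite: Imai1976HodgeGroups, §2 (p. 368)] [cite: Milne2017, Def. 19.7]
[cite: MoonenZarhin1999LowDim, (0.2)(4)] -/
theorem forall_finite_or_eq_of_homRat {P : Matrix ι₂ ι₁ ℚ} {Q : Matrix ι₁ ι₂ ℚ} (hP : P ∈ homRat Φ₁ Φ₂)
    (hQP : Q * P = 1) (hPQ : P * Q = 1)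
    (hQ'₁ : ∀ N : Subgroup (SpecialLinearGroup ι₁ ℂ), IsZariskiClosed N → IsAutStable N → N ≤ hodgeGroupC Φ₁ →
      (∀ g ∈ hodgeGroupC Φ₁, ∀ x ∈ N, g * x * g⁻¹ ∈ N) → (N : Set (SpecialLinearGroup ι₁ ℂ)).Finite ∨ N = hodgeGroupC Φ₁) :
    ∀ N : Subgroup (SpecialLinearGroup ι₂ ℂ), IsZariskiClosed N → IsAutStable N → N ≤ hodgeGroupC Φ₂ →
      (∀ g ∈ hodgeGroupC Φ₂, ∀ x ∈ N, g * x * g⁻¹ ∈ N) → (N : Set (SpecialLinearGroup ι₂ ℂ)).Finite ∨ N = hodgeGroupC Φ₂ := by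
  intro N hNc hNs hNle hNn
  -- Milne's map `c : γ ↦ P γ Q` and its inverse `c' : δ ↦ Q δ P`
  set c := conjSLC (P.map (algebraMap ℚ ℂ)) (Q.map (algebraMap ℚ ℂ)) (mapC_mul_eq_one₄₃ hQP) (mapC_mul_eq_one₄₃ hPQ)
  set c' := conjSLC (Q.map (algebraMap ℚ ℂ)) (P.map (algebraMap ℚ ℂ)) (mapC_mul_eq_one₄₃ hPQ) (mapC_mul_eq_one₄₃ hQP)
  have hHg : hodgeGroupC Φ₂ = (hodgeGroupC Φ₁).map c := hodgeGroupC_eq_map_conjSLC_of_homRat hP hQP hPQ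
  have hc'c : ∀ x, c' (c x) = x := fun x ↦ conjSLC_conjSLC _ _ x
  -- the pulled-back subgroup `N' = Q N P ≤ Hg(X₁)(ℂ)`
  have hN'c : IsZariskiClosed (N.map c') := hNc.map_conjSLC _ _
  have hN's : IsAutStable (N.map c') := hNs.map_conjSLC hPQ hQP
  have hmemHg : ∀ {y}, y ∈ hodgeGroupC Φ₂ ↔ c' y ∈ hodgeGroupC Φ₁ := fun {y} ↦ by
    rw [hHg, mem_map_conjSLC_iff]
  have hle' : N.map c' ≤ hodgeGroupC Φ₁ := by
    rintro _ ⟨y, hy, rfl⟩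
    exact hmemHg.1 (hNle hy)
  have hn' : ∀ g ∈ hodgeGroupC Φ₁, ∀ x ∈ N.map c', g * x * g⁻¹ ∈ N.map c' := by
    rintro g hg _ ⟨y, hy, rfl⟩
    have hcg : c g ∈ hodgeGroupC Φ₂ := hmemHg.2 (by rwa [hc'c])
    refine ⟨c g * y * (c g)⁻¹, hNn (c g) hcg y hy, ?_⟩
    rw [map_mul, map_mul, map_inv, hc'c]
  rcases hQ'₁ _ hN'c hN's hle' hn' with hfin | hall
  · left
    have hN : N = (N.map c').map c := (map_map_conjSLC _ _ N).symm
    rw [hN, Subgroup.coe_map]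
    exact hfin.image _
  · right
    rw [← map_map_conjSLC (mapC_mul_eq_one₄₃ hPQ) (mapC_mul_eq_one₄₃ hQP) N, hHg]
    exact congrArg (Subgroup.map c) hall

/-- **«`Hg(X)` ALMOST `ℚ`-SIMPLE» (`(hQ′)`) IS INVARIANT UNDER `Hom_ℚ`-ISOMORPHISMS** (mutually inverse `P ∈ Hom_ℚ(X₁, X₂)`,
`Q ∈ Hom_ℚ(X₂, X₁)`). [cite: MoonenZarhin1999LowDim, (0.2)(4)] [cite: Milne2017, Def. 19.7] [cite: Springer1998, Prop. 2.2.1 and 11.2.8 (i)] -/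
theorem almostRatSimple_iff_of_homRat {P : Matrix ι₂ ι₁ ℚ} {Q : Matrix ι₁ ι₂ ℚ} (hP : P ∈ homRat Φ₁ Φ₂)
    (hQ : Q ∈ homRat Φ₂ Φ₁) (hQP : Q * P = 1) (hPQ : P * Q = 1) :
    (∀ N : Subgroup (SpecialLinearGroup ι₂ ℂ), IsZariskiClosed N → IsAutStable N → N ≤ hodgeGroupC Φ₂ →
      (∀ g ∈ hodgeGroupC Φ₂, ∀ x ∈ N, g * x * g⁻¹ ∈ N) → (N : Set (SpecialLinearGroup ι₂ ℂ)).Finite ∨ N = hodgeGroupC Φ₂) ↔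
    ∀ N : Subgroup (SpecialLinearGroup ι₁ ℂ), IsZariskiClosed N → IsAutStable N → N ≤ hodgeGroupC Φ₁ →
      (∀ g ∈ hodgeGroupC Φ₁, ∀ x ∈ N, g * x * g⁻¹ ∈ N) → (N : Set (SpecialLinearGroup ι₁ ℂ)).Finite ∨ N = hodgeGroupC Φ₁ :=
  ⟨forall_finite_or_eq_of_homRat hQ hPQ hQP, forall_finite_or_eq_of_homRat hP hQP hPQ⟩

/-- **For an isogeny `f : X₁ → X₂`: `Hg(X₂)` is almost `ℚ`-simple iff `Hg(X₁)` is** (`(hQ′)` rendering).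
[cite: MoonenZarhin1999LowDim, (0.2)(4)] [cite: vanGeemen1994HodgeAV, 3.6] [cite: Milne2017, Def. 19.7] -/
theorem IsIsogeny.almostRatSimple_iff {A : Matrix ι₂ ι₁ ℤ} (hA : IsIsogeny Φ₁ Φ₂ A) :
    (∀ N : Subgroup (SpecialLinearGroup ι₂ ℂ), IsZariskiClosed N → IsAutStable N → N ≤ hodgeGroupC Φ₂ →
      (∀ g ∈ hodgeGroupC Φ₂, ∀ x ∈ N, g * x * g⁻¹ ∈ N) → (N : Set (SpecialLinearGroup ι₂ ℂ)).Finite ∨ N = hodgeGroupC Φ₂) ↔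
    ∀ N : Subgroup (SpecialLinearGroup ι₁ ℂ), IsZariskiClosed N → IsAutStable N → N ≤ hodgeGroupC Φ₁ →
      (∀ g ∈ hodgeGroupC Φ₁, ∀ x ∈ N, g * x * g⁻¹ ∈ N) → (N : Set (SpecialLinearGroup ι₁ ℂ)).Finite ∨ N = hodgeGroupC Φ₁ := by
  obtain ⟨Q, hQ, hQP, hPQ⟩ := hA.exists_homRat_inverse
  exact almostRatSimple_iff_of_homRat hA.map_intCast_mem_homRat hQ hQP hPQ

variable (Φ₁ Φ₂) in
/-- **ISOGENOUS COMPLEX TORI HAVE SIMULTANEOUSLY ALMOST `ℚ`-SIMPLE HODGE GROUPS** (`(hQ′)` rendering: every Zariski-closed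
`Aut(ℂ)`-stable `N ≤ Hg(X)(ℂ)` normalised by `Hg(X)(ℂ)` is finite or all). [cite: MoonenZarhin1999LowDim, (0.2)(4)]
[cite: vanGeemen1994HodgeAV, 3.6] [cite: Milne2017, Def. 19.7] -/
theorem IsIsogenous.almostRatSimple_iff (h : IsIsogenous Φ₁ Φ₂) :
    (∀ N : Subgroup (SpecialLinearGroup ι₁ ℂ), IsZariskiClosed N → IsAutStable N → N ≤ hodgeGroupC Φ₁ →
      (∀ g ∈ hodgeGroupC Φ₁, ∀ x ∈ N, g * x * g⁻¹ ∈ N) → (N : Set (SpecialLinearGroup ι₁ ℂ)).Finite ∨ N = hodgeGroupC Φ₁) ↔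
    ∀ N : Subgroup (SpecialLinearGroup ι₂ ℂ), IsZariskiClosed N → IsAutStable N → N ≤ hodgeGroupC Φ₂ →
      (∀ g ∈ hodgeGroupC Φ₂, ∀ x ∈ N, g * x * g⁻¹ ∈ N) → (N : Set (SpecialLinearGroup ι₂ ℂ)).Finite ∨ N = hodgeGroupC Φ₂ := by
  obtain ⟨A, hA⟩ := h
  exact hA.almostRatSimple_iff.symm

variable (Φ₁ Φ₂) in
/-- **… and simultaneously almost `ℚ`-simple in the LIE-ALGEBRA rendering `(hQ)`** (every Zariski-connected `M ≤ Hg(X)(ℂ)` normalised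
by `Hg(X)(ℂ)` whose Lie algebra is spanned by its rational points is `{e}` or all) — through g43-#2's `(hQ′) ⟺ (hQ)`.
[cite: MoonenZarhin1999LowDim, (0.2)(4)] [cite: Springer1998, 11.1.4, 12.1.1, 12.1.2] [cite: Milne2017, Def. 19.7] -/
theorem IsIsogenous.almostQSimple_iff (h : IsIsogenous Φ₁ Φ₂) :
    (∀ M : Subgroup (GL ι₁ ℂ), IsZConnected M → M ≤ (hodgeGroupC Φ₁).map Matrix.SpecialLinearGroup.toGL →
      (∀ g ∈ (hodgeGroupC Φ₁).map Matrix.SpecialLinearGroup.toGL, M.map (MulAut.conj g : GL ι₁ ℂ →* GL ι₁ ℂ) = M) →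
        (lieAlgebraGL M : Set (Matrix ι₁ ι₁ ℂ)) = Submodule.span ℂ ((fun A : Matrix ι₁ ι₁ ℚ ↦ A.map ((↑) : ℚ → ℂ)) ''
          {A : Matrix ι₁ ι₁ ℚ | A.map ((↑) : ℚ → ℂ) ∈ lieAlgebraGL M}) →
          M = ⊥ ∨ M = (hodgeGroupC Φ₁).map Matrix.SpecialLinearGroup.toGL) ↔
    ∀ M : Subgroup (GL ι₂ ℂ), IsZConnected M → M ≤ (hodgeGroupC Φ₂).map Matrix.SpecialLinearGroup.toGL →
      (∀ g ∈ (hodgeGroupC Φ₂).map Matrix.SpecialLinearGroup.toGL, M.map (MulAut.conj g : GL ι₂ ℂ →* GL ι₂ ℂ) = M) →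
        (lieAlgebraGL M : Set (Matrix ι₂ ι₂ ℂ)) = Submodule.span ℂ ((fun A : Matrix ι₂ ι₂ ℚ ↦ A.map ((↑) : ℚ → ℂ)) ''
          {A : Matrix ι₂ ι₂ ℚ | A.map ((↑) : ℚ → ℂ) ∈ lieAlgebraGL M}) →
          M = ⊥ ∨ M = (hodgeGroupC Φ₂).map Matrix.SpecialLinearGroup.toGL := by
  rw [← almostRatSimple_iff_almostQSimple Φ₁, ← almostRatSimple_iff_almostQSimple Φ₂]
  exact h.almostRatSimple_iff

end Isogeny

/-! ### §3 Products with a factor isogenous to one with almost `ℚ`-simple Hodge group -/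

section Products

variable {ι₁ ι₂ ι₃ : Type*} [Fintype ι₁] [Fintype ι₂] [Fintype ι₃] [DecidableEq ι₁] [DecidableEq ι₂] [DecidableEq ι₃]
  {E₁ E₂ E₃ : Type*} [NormedAddCommGroup E₁] [NormedSpace ℂ E₁] [NormedAddCommGroup E₂] [NormedSpace ℂ E₂]
  [NormedAddCommGroup E₃] [NormedSpace ℂ E₃]
  (Φ₁ : (ι₁ → ℝ) ≃L[ℝ] E₁) (Φ₂ : (ι₂ → ℝ) ≃L[ℝ] E₂) {Φ₃ : (ι₃ → ℝ) ≃L[ℝ] E₃}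

/-- **`X₂ ∼ X₃` with `Hg(X₃)` almost `ℚ`-simple ⟹ the Goursat kernel `K₂` of `Hg(X₁ × X₂)(ℂ)` is finite or `Hg(X₂)(ℂ)`.**
[cite: MoonenZarhin1999LowDim, (0.2)(4) and §3 Lemma (3.6), proof] [cite: Gordon1997, §2.16 Proposition] -/
theorem IsIsogenous.finite_hodgeGroupCProdInr_or_eq_of_almostRatSimple (h : IsIsogenous Φ₂ Φ₃)
    (hQ' : ∀ N : Subgroup (SpecialLinearGroup ι₃ ℂ), IsZariskiClosed N → IsAutStable N → N ≤ hodgeGroupC Φ₃ →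
      (∀ g ∈ hodgeGroupC Φ₃, ∀ x ∈ N, g * x * g⁻¹ ∈ N) → (N : Set (SpecialLinearGroup ι₃ ℂ)).Finite ∨ N = hodgeGroupC Φ₃) :
    ((hodgeGroupCProdInr Φ₁ Φ₂ : Subgroup (SpecialLinearGroup ι₂ ℂ)) : Set (SpecialLinearGroup ι₂ ℂ)).Finite ∨
      hodgeGroupCProdInr Φ₁ Φ₂ = hodgeGroupC Φ₂ :=
  ComplexTorus.finite_hodgeGroupCProdInr_or_eq_of_almostRatSimple Φ₁ Φ₂ ((h.almostRatSimple_iff Φ₂ Φ₃).2 hQ')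

/-- **`X₂ ∼ X₃` with `Hg(X₃)` almost `ℚ`-simple ⟹ `K₂` finite or `Hg(X₁ × X₂)(ℂ) = Hg(X₁)(ℂ) × Hg(X₂)(ℂ)`.**
[cite: MoonenZarhin1999LowDim, (0.2)(4) and §3 Lemma (3.6)] [cite: Gordon1997, §2.16 Proposition] -/
theorem IsIsogenous.finite_hodgeGroupCProdInr_or_hodgeGroupC_prod_eq_blockDiagProd_of_almostRatSimple (h : IsIsogenous Φ₂ Φ₃)
    (hQ' : ∀ N : Subgroup (SpecialLinearGroup ι₃ ℂ), IsZariskiClosed N → IsAutStable N → N ≤ hodgeGroupC Φ₃ →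
      (∀ g ∈ hodgeGroupC Φ₃, ∀ x ∈ N, g * x * g⁻¹ ∈ N) → (N : Set (SpecialLinearGroup ι₃ ℂ)).Finite ∨ N = hodgeGroupC Φ₃) :
    ((hodgeGroupCProdInr Φ₁ Φ₂ : Subgroup (SpecialLinearGroup ι₂ ℂ)) : Set (SpecialLinearGroup ι₂ ℂ)).Finite ∨
      hodgeGroupC (prodPeriod Φ₁ Φ₂) = blockDiagProd (hodgeGroupC Φ₁) (hodgeGroupC Φ₂) :=
  (h.finite_hodgeGroupCProdInr_or_eq_of_almostRatSimple Φ₁ Φ₂ hQ').imp_right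
    (ComplexTorus.hodgeGroupC_prod_eq_blockDiagProd_of_hodgeGroupCProdInr_eq Φ₁ Φ₂)

/-- **`X₂ ∼ X₃`, `Hg(X₃)` almost `ℚ`-simple and `dim_ℚ 𝒜(X₁) < dim_ℚ 𝒜(X₂)` ⟹ `Hg(X₁ × X₂)(ℂ) = Hg(X₁)(ℂ) × Hg(X₂)(ℂ)`.**
[cite: MoonenZarhin1999LowDim, (0.2)(4) and §3 Lemma (3.6)] [cite: Springer1998, 4.4.5–4.4.7] -/
theorem IsIsogenous.hodgeGroupC_prod_eq_blockDiagProd_of_almostRatSimple_of_finrank_lt (h : IsIsogenous Φ₂ Φ₃)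
    (hQ' : ∀ N : Subgroup (SpecialLinearGroup ι₃ ℂ), IsZariskiClosed N → IsAutStable N → N ≤ hodgeGroupC Φ₃ →
      (∀ g ∈ hodgeGroupC Φ₃, ∀ x ∈ N, g * x * g⁻¹ ∈ N) → (N : Set (SpecialLinearGroup ι₃ ℂ)).Finite ∨ N = hodgeGroupC Φ₃)
    (hlt : finrank ℚ (hodgeGroupLieRat Φ₁) < finrank ℚ (hodgeGroupLieRat Φ₂)) :
    hodgeGroupC (prodPeriod Φ₁ Φ₂) = blockDiagProd (hodgeGroupC Φ₁) (hodgeGroupC Φ₂) :=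
  ComplexTorus.hodgeGroupC_prod_eq_blockDiagProd_of_almostQSimple_of_finrank_lt Φ₁ Φ₂
    (ComplexTorus.forall_eq_bot_or_eq_of_almostRatSimple Φ₂ ((h.almostRatSimple_iff Φ₂ Φ₃).2 hQ')) hlt

end Products

end ComplexTorus

end Literature.Geometry.Kaehler
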